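import Literature.NumberTheory.EllipticCurves.PAdicTwoVariableTransform
import HarnessLib

/-!
# Push-forward of bounded `p`-adic distributions and the change-of-variables formula

For the bounded distributions of `PAdicDistributionIntegral.lean` (level data on a profinite tower
`T` of a compact ultrametric space `X`, values in a non-archimedean field `𝕜`) we define the
**push-forward** along a level-compatible family of cell maps `φ_n : T.Cell n → T'.Cell n`
(`ProfiniteTower.CellMap`; e.g. the maps induced modulo `p^n` by a `ℤ_p`-linear map of `ℤ_p × ℤ_p`):

  `(φ_* D)_n(a') = Σ_{φ_n a = a'} D_n(a)`      (`BoundedDistribution.map`, `map_μ`),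

prove that it is again a bounded distribution with the same bound (distribution relation
`sum_fiber` from that of `D` and `φ_n ∘ trans = trans' ∘ φ_{n+1}`; the bound by the ultrametric
inequality), and prove the **change-of-variables formula**

  `∫ f d(φ_* D) = ∫ (f ∘ Φ) dD`      (`integral_map`)

for any point map `Φ : X → X'` lying over `φ` (`proj' n (Φ x) = φ_n (proj n x)`) and `f`, `f ∘ Φ`
uniformly continuous: the Riemann sums of the two sides live on the same cells of `T'` and differ
only in the choice of sample points (`riemannSum_map`, `norm_riemannSum_map_sub_le`).

Main instance (`ProfiniteTower.linearCellMap`, `BoundedDistribution.linearMap`,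
`integral_linearMap`): the right action of a matrix `(a b; c d) ∈ M₂(ℤ_p)` on `ℤ_p × ℤ_p`,
`(x, y) ↦ (x, y)·(a b; c d) = (a x + c y, b x + d y)`, which is how `Σ₀(p)` acts on the measures
`𝔻` of Greenberg–Stevens (1993, §1, §4) and on Kitagawa's two-variable measures (Kitagawa 1994, §5;
Delbourgo 2008, §4.2–4.4): `∫ f d(D·M) = ∫ f((x, y)·M) dD(x, y)`.

Brick B2a of the bottom-up plan recorded with the named fact
`greenbergStevens_kitagawa_twoVariable_interpolation_allBranches`.  Everything is proved; no named facts.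

## References

* R. Greenberg, G. Stevens, Invent. Math. 111 (1993), §1, §4. [GreenbergStevens1993]
* B. Mazur, J. Tate, J. Teitelbaum, Invent. Math. 84 (1986), §I.11. [MazurTateTeitelbaum1986Invent]
* D. Delbourgo, *Elliptic Curves and Big Galois Representations* (2008), §4.2–4.4. [Delbourgo2008]
-/

noncomputable section

open Filter Topology

namespace Literature.NumberTheory.EllipticCurves

/-! ### Level-compatible families of cell maps -/

namespace ProfiniteTower

variable {X X' : Type*} [PseudoMetricSpace X] [PseudoMetricSpace X']

/-- A **level-compatible family of cell maps** between two profinite towers: maps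
`φ_n : T.Cell n → T'.Cell n` commuting with the transition maps.  A point map `Φ : X → X'` *lies
over* `φ` when `proj' n (Φ x) = φ_n (proj n x)` (hypothesis `hΦ` of `integral_map`). [folklore] -/
structure CellMap (T : ProfiniteTower X) (T' : ProfiniteTower X') where
  /-- the map on level-`n` cells -/
  map : (n : ℕ) → T.Cell n → T'.Cell n
  /-- compatibility with the transition maps -/
  map_trans : ∀ (n : ℕ) (b : T.Cell (n + 1)), map n (T.trans n b) = T'.trans n (map (n + 1) b)

end ProfiniteTower

/-! ### Push-forward of bounded distributions -/

namespace BoundedDistribution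

variable {X X' : Type*} [PseudoMetricSpace X] [PseudoMetricSpace X']
  {T : ProfiniteTower X} {T' : ProfiniteTower X'}
  {𝕜 : Type*} [NormedField 𝕜] [IsUltrametricDist 𝕜]
  (D : BoundedDistribution T 𝕜) (φ : T.CellMap T')

/-- **The push-forward `φ_* D`** of a bounded distribution along a level-compatible family of cell
maps: `(φ_* D)_n(a') = Σ_{φ_n a = a'} D_n(a)`; a bounded distribution with the same bound (values in a
non-archimedean field). [folklore] -/
def map : BoundedDistribution T' 𝕜 where
  μ n a' := ∑ a ∈ Finset.univ.filter (fun a : T.Cell n => φ.map n a = a'), D.μ n a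
  sum_fiber n a' := by
    classical
    -- `Σ_{trans' b' = a'} Σ_{φ b = b'} D b = Σ_{trans' (φ b) = a'} D b = Σ_{φ (trans b) = a'} D b`
    rw [Finset.sum_fiberwise_eq_sum_filter]
    have h1 : (Finset.univ.filter fun b : T.Cell (n + 1) =>
        φ.map (n + 1) b ∈ Finset.univ.filter fun b' : T'.Cell (n + 1) => T'.trans n b' = a') =
        Finset.univ.filter fun b : T.Cell (n + 1) =>
          T.trans n b ∈ Finset.univ.filter fun a : T.Cell n => φ.map n a = a' := by
      ext b
      simp only [Finset.mem_filter, Finset.mem_univ, true_and, φ.map_trans]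
    rw [h1, ← Finset.sum_fiberwise_eq_sum_filter]
    exact Finset.sum_congr rfl fun a _ => D.sum_fiber n a
  bound := D.bound
  bound_nonneg := D.bound_nonneg
  norm_le n a' := IsUltrametricDist.norm_sum_le_of_forall_le_of_nonneg D.bound_nonneg
    fun a _ => D.norm_le n a

/-- The level data of the push-forward. [folklore] -/
@[simp] theorem map_μ (n : ℕ) (a' : T'.Cell n) :
    (D.map φ).μ n a' = ∑ a ∈ Finset.univ.filter (fun a : T.Cell n => φ.map n a = a'), D.μ n a := rfl

/-- The bound of the push-forward is that of `D`. [folklore] -/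
@[simp] theorem map_bound : (D.map φ).bound = D.bound := rfl

/-- **Riemann sums of the push-forward**: `RS(φ_* D, f, n) = Σ_a D_n(a) · f(repr' (φ_n a))`.
[folklore] -/
theorem riemannSum_map (f : X' → 𝕜) (n : ℕ) :
    (D.map φ).riemannSum f n = ∑ a : T.Cell n, D.μ n a * f (T'.repr n (φ.map n a)) := by
  classical
  rw [riemannSum_def]
  simp only [map_μ, Finset.sum_mul]
  rw [← Finset.sum_fiberwise Finset.univ (φ.map n) fun a => D.μ n a * f (T'.repr n (φ.map n a))]
  refine Finset.sum_congr rfl fun a' _ => Finset.sum_congr rfl fun a ha => ?_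
  rw [(Finset.mem_filter.mp ha).2]

/-- **The Riemann sums of `φ_* D` for `f` and of `D` for `f ∘ Φ` differ by at most `‖D‖ · δ`** when
`Φ` lies over `φ` and `f` varies by at most `δ` on the level-`n` cells of `T'` (same cells,
different sample points). [folklore] -/
theorem norm_riemannSum_map_sub_le {Φ : X → X'} (hΦ : ∀ (n : ℕ) (x : X), T'.proj n (Φ x) = φ.map n (T.proj n x))
    {f : X' → 𝕜} {δ : ℝ} (hδ : 0 ≤ δ) {n : ℕ}
    (hf : ∀ x y : X', T'.proj n x = T'.proj n y → ‖f x - f y‖ ≤ δ) :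
    ‖(D.map φ).riemannSum f n - D.riemannSum (f ∘ Φ) n‖ ≤ D.bound * δ := by
  rw [riemannSum_map, riemannSum_def, ← Finset.sum_sub_distrib]
  refine IsUltrametricDist.norm_sum_le_of_forall_le_of_nonneg (mul_nonneg D.bound_nonneg hδ)
    fun a _ => ?_
  rw [Function.comp_apply, ← mul_sub, norm_mul]
  refine mul_le_mul (D.norm_le n a) (hf _ _ ?_) (norm_nonneg _) D.bound_nonneg
  rw [T'.proj_repr, hΦ, T.proj_repr]

/-- **Change of variables**: `∫ f d(φ_* D) = ∫ (f ∘ Φ) dD` for `Φ` lying over `φ` and `f`, `f ∘ Φ`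
uniformly continuous (Mazur–Tate–Teitelbaum 1986, §I.11, functoriality of `p`-adic integration;
Greenberg–Stevens 1993, §1). [folklore] -/
theorem integral_map [CompleteSpace 𝕜] {Φ : X → X'}
    (hΦ : ∀ (n : ℕ) (x : X), T'.proj n (Φ x) = φ.map n (T.proj n x))
    {f : X' → 𝕜} (hf : UniformContinuous f) (hfΦ : UniformContinuous (f ∘ Φ)) :
    (D.map φ).integral f = D.integral (f ∘ Φ) := by
  have h1 : Tendsto ((D.map φ).riemannSum f) atTop (𝓝 ((D.map φ).integral f)) :=
    (D.map φ).tendsto_riemannSum_integral hf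
  have h2 : Tendsto (D.riemannSum (f ∘ Φ)) atTop (𝓝 (D.integral (f ∘ Φ))) :=
    D.tendsto_riemannSum_integral hfΦ
  have h0 : Tendsto (fun n => (D.map φ).riemannSum f n - D.riemannSum (f ∘ Φ) n) atTop (𝓝 0) := by
    refine Metric.tendsto_atTop.mpr fun ε hε => ?_
    have hb : 0 < D.bound + 1 := by linarith [D.bound_nonneg]
    obtain ⟨N, hN⟩ := T'.exists_forall_norm_sub_le hf (div_pos hε hb)
    refine ⟨N, fun n hn => ?_⟩
    rw [dist_zero_right]
    calc ‖(D.map φ).riemannSum f n - D.riemannSum (f ∘ Φ) n‖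
        ≤ D.bound * (ε / (D.bound + 1)) :=
          D.norm_riemannSum_map_sub_le φ hΦ (div_pos hε hb).le (hN n hn)
      _ < ε := by
          rw [mul_div_assoc', div_lt_iff₀ hb]
          nlinarith [D.bound_nonneg]
  have h3 := h0.add h2
  simp only [sub_add_cancel, zero_add] at h3
  exact tendsto_nhds_unique h1 h3

/-- **Push-forward preserves total mass at level `0`** and, more generally, sums of level data over
all cells: `Σ_{a'} (φ_* D)_n(a') = Σ_a D_n(a)`. [folklore] -/
theorem sum_map_μ (n : ℕ) : ∑ a' : T'.Cell n, (D.map φ).μ n a' = ∑ a : T.Cell n, D.μ n a := by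
  classical
  simp only [map_μ]
  exact Finset.sum_fiberwise Finset.univ (φ.map n) (D.μ n)

end BoundedDistribution

/-! ### The right action of `M₂(ℤ_p)` on `ℤ_p × ℤ_p` and on its bounded distributions -/

section Linear

variable {p : ℕ} [Fact p.Prime]

/-- The right action of `(a b; c d) ∈ M₂(ℤ_p)` on row vectors: `(x, y) ↦ (a x + c y, b x + d y)`.
[folklore] -/
def linMap (a b c d : ℤ_[p]) (v : ℤ_[p] × ℤ_[p]) : ℤ_[p] × ℤ_[p] :=
  (a * v.1 + c * v.2, b * v.1 + d * v.2)

/-- Unfolding lemma for `linMap`. [folklore] -/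
theorem linMap_apply (a b c d : ℤ_[p]) (v : ℤ_[p] × ℤ_[p]) :
    linMap a b c d v = (a * v.1 + c * v.2, b * v.1 + d * v.2) := rfl

/-- `linMap` is uniformly continuous. [folklore] -/
theorem uniformContinuous_linMap (a b c d : ℤ_[p]) : UniformContinuous (linMap a b c d) :=
  CompactSpace.uniformContinuous_of_continuous (by unfold linMap; fun_prop)

/-- The same action modulo `p^n`: `(x, y) ↦ (ā x + c̄ y, b̄ x + d̄ y)` on `(ℤ/p^n)²`. [folklore] -/
def linMapMod (a b c d : ℤ_[p]) (n : ℕ) (v : ZMod (p ^ n) × ZMod (p ^ n)) : ZMod (p ^ n) × ZMod (p ^ n) :=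
  (PadicInt.toZModPow n a * v.1 + PadicInt.toZModPow n c * v.2,
    PadicInt.toZModPow n b * v.1 + PadicInt.toZModPow n d * v.2)

/-- Unfolding lemma for `linMapMod`. [folklore] -/
theorem linMapMod_apply (a b c d : ℤ_[p]) (n : ℕ) (v : ZMod (p ^ n) × ZMod (p ^ n)) :
    linMapMod a b c d n v = (PadicInt.toZModPow n a * v.1 + PadicInt.toZModPow n c * v.2,
      PadicInt.toZModPow n b * v.1 + PadicInt.toZModPow n d * v.2) := rfl

/-- Reduction `ℤ/p^{n+1} → ℤ/p^n` of `toZModPow (n+1) a` is `toZModPow n a`. [folklore] -/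
theorem castHom_toZModPow_succ (n : ℕ) (a : ℤ_[p]) :
    ZMod.castHom (pow_dvd_pow p n.le_succ) (ZMod (p ^ n)) (PadicInt.toZModPow (n + 1) a) =
      PadicInt.toZModPow n a := by
  rw [ZMod.castHom_apply, PadicInt.cast_toZModPow _ _ n.le_succ]

variable (p) in
/-- **The level maps of the linear action** form a level-compatible family on the tower
`ℤ_p × ℤ_p = lim (ℤ/p^n)²`. [folklore] -/
def ProfiniteTower.linearCellMap (a b c d : ℤ_[p]) : (padicIntSq p).CellMap (padicIntSq p) where
  map n v := linMapMod a b c d n v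
  map_trans n v := by
    obtain ⟨x, y⟩ := v
    simp only [ProfiniteTower.prod_trans, ProfiniteTower.padicInt_trans, linMapMod_apply, map_add,
      map_mul, castHom_toZModPow_succ]
    rfl

/-- The level maps of `linearCellMap` are `linMapMod`. [folklore] -/
@[simp] theorem ProfiniteTower.linearCellMap_map (a b c d : ℤ_[p]) (n : ℕ)
    (v : ZMod (p ^ n) × ZMod (p ^ n)) :
    (ProfiniteTower.linearCellMap p a b c d).map n v = linMapMod a b c d n v := rfl

/-- `linMap` lies over `linearCellMap`: reduction modulo `p^n` commutes with the linear action.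
[folklore] -/
theorem proj_linMap (a b c d : ℤ_[p]) (n : ℕ) (v : ℤ_[p] × ℤ_[p]) :
    (padicIntSq p).proj n (linMap a b c d v) =
      (ProfiniteTower.linearCellMap p a b c d).map n ((padicIntSq p).proj n v) := by
  obtain ⟨x, y⟩ := v
  simp only [ProfiniteTower.prod_proj, ProfiniteTower.padicInt_proj, linMap_apply,
    ProfiniteTower.linearCellMap_map, linMapMod_apply, map_add, map_mul]
  rfl

namespace BoundedDistribution

variable {𝕜 : Type*} [NormedField 𝕜] [IsUltrametricDist 𝕜]
  (D : BoundedDistribution (padicIntSq p) 𝕜)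

/-- **The right action `D·M` of `M = (a b; c d) ∈ M₂(ℤ_p)` on bounded distributions on
`ℤ_p × ℤ_p`**: the push-forward along `(x, y) ↦ (x, y)·M` (Greenberg–Stevens 1993, §1, the
`Σ₀(p)`-module `𝔻`; Delbourgo 2008, §4.2). [cite: Delbourgo2008, §4.2] -/
def linearMap (a b c d : ℤ_[p]) : BoundedDistribution (padicIntSq p) 𝕜 :=
  D.map (ProfiniteTower.linearCellMap p a b c d)

/-- Unfolding lemma for `linearMap`. [folklore] -/
theorem linearMap_def (a b c d : ℤ_[p]) :
    D.linearMap a b c d = D.map (ProfiniteTower.linearCellMap p a b c d) := rfl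

/-- The bound of `D·M` is that of `D`. [folklore] -/
@[simp] theorem linearMap_bound (a b c d : ℤ_[p]) : (D.linearMap a b c d).bound = D.bound := rfl

/-- **Change of variables for the matrix action**: `∫ f d(D·M) = ∫ f((x, y)·M) dD(x, y)` for `f`
uniformly continuous on `ℤ_p × ℤ_p` (Greenberg–Stevens 1993, §1 (1.1)). [folklore] -/
theorem integral_linearMap [CompleteSpace 𝕜] (a b c d : ℤ_[p]) {f : ℤ_[p] × ℤ_[p] → 𝕜}
    (hf : UniformContinuous f) :
    (D.linearMap a b c d).integral f = D.integral (f ∘ linMap a b c d) :=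
  D.integral_map _ (proj_linMap a b c d) hf (hf.comp (uniformContinuous_linMap a b c d))

end BoundedDistribution

end Linear

end Literature.NumberTheory.EllipticCurves

end
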